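import Literature.Topology.FourManifolds.TubeFlowGeometry
import HarnessLib

/-!
# Flow geometry of a `2`-handle tube, II: reaching the attaching level forwards from below

Topic `Literature/Topology/FourManifolds`; complement to `TubeFlowGeometry.lean` (step E3b of the
Morse-theoretic construction of Gay–Kirby's trisection, fact seat
`provefact-Literature.Topology.FourManifolds.exists_isBalancedGKTrisection`).  Everything here is
**proved**; no definitions.

For an index-`2` Milnor box `D` about `c` (coordinates `A = |x⃗|²`, `B = |y⃗|²`,
`f = f c - A + B`, trajectories `(e^{-t} x⃗, e^{t} y⃗)`, Milnor 1965, proof of Thm. 3.12): a point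
`z` of the chart domain *below* the level `f c - η` with `A(z) ≤ A_max`, `A_max < ε²`,
`A(z) B(z) < 4 η ε²` flows **forwards**, inside the closed box, to the level `f c - η`
(`MilnorBox.exists_forward_level`): if `B(z) > 0` the orbit leaves the box through the face
`B = 4ε²` (the exit lemma `MilnorBox.exists_exit`) where `f > f c - η`; if `B(z) = 0` it runs down
the stable disc to the attaching sphere `A = η`.  Consequences for the global flow of a
gradient-like field as in part I: the level projection is `flow z t`, `t ≥ 0`, with `A·B` and
Gay–Kirby's tube function conserved (`MilnorBox.exists_levelProj_eq_flow_of_le`).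

## References

* J. Milnor, *Lectures on the h-cobordism theorem* (1965), proof of Thm. 3.12 (PDF p. 18),
  Thm. 4.1. [MilnorHCobordism1965]
* D. Gay, R. Kirby, *Trisecting 4-manifolds*, Geom. Topol. 20 (2016), §4, Lemma 14. [GayKirby2016]
-/

open scoped Manifold ContDiff Topology
open Set Function Filter Metric

noncomputable section

universe u

namespace Literature.Topology.FourManifolds

open Flow

/-- Local notation: `𝔼 n` is the model Euclidean space `EuclideanSpace ℝ (Fin n)`. -/
local notation "𝔼 " n:arg => EuclideanSpace ℝ (Fin n)

variable {M : Type u} [TopologicalSpace M] [ChartedSpace (𝔼 4) M]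
  {f : M → ℝ} {X : Π x : M, TangentSpace (𝓡 4) x} {θ : ℝ × M → M} {c : M}

namespace MilnorBox

/-- **Reaching the level forwards from below.**  Let `z` be a point of the chart domain of an
index-`2` box with `f z ≤ f c - η`, `A(z) ≤ A_max < ε²` and `A(z)·B(z) < 4ηε²`, `0 < η`.  Then at
some time `t ≥ 0` the orbit is on the level `f = f c - η`, having stayed in the closed box on
`[0, t]`. [cite: MilnorHCobordism1965, proof of Thm. 3.12 (PDF p. 18)] [cite: GayKirby2016, §4] -/
theorem exists_forward_level [T2Space M] (D : MilnorBox (𝓡 4) f X c) (h : IsFlowOf (𝓡 4) X θ)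
    (hf : Continuous f) {η Amax : ℝ} (hη : 0 < η) (hAmax : Amax < D.ε ^ 2) {z : M}
    (hz : z ∈ D.chart.source) (hA : sqSumLT D.k (D.coord z) ≤ Amax) (hfz : f z ≤ f c - η)
    (hP : sqSumLT D.k (D.coord z) * sqSumGE D.k (D.coord z) < 4 * η * D.ε ^ 2) :
    ∃ t, 0 ≤ t ∧ (∀ r ∈ Icc 0 t, θ (r, z) ∈ {q' | q' ∈ D.chart.source ∧ sqSumLT D.k (D.coord q') ≤ D.ε ^ 2 ∧
        sqSumGE D.k (D.coord q') ≤ 4 * D.ε ^ 2}) ∧ f (θ (t, z)) = f c - η := by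
  have hε := D.eps_pos
  set A₀ := sqSumLT D.k (D.coord z) with hA₀
  set B₀ := sqSumGE D.k (D.coord z) with hB₀
  have hA0nn : 0 ≤ A₀ := sqSumLT_nonneg _ _
  have hB0nn : 0 ≤ B₀ := sqSumGE_nonneg _ _
  have hfz' : f z = f c - A₀ + B₀ := D.apply_eq_sub_add hz
  -- `η ≤ A₀ - B₀`, so `A₀ ≥ η > 0` and `B₀ ≤ A₀ < ε²`
  have hAη : η + B₀ ≤ A₀ := by linarith
  have hApos : 0 < A₀ := by linarith
  have hAz : A₀ < D.ε ^ 2 := lt_of_le_of_lt hA hAmax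
  have hBz : B₀ < 4 * D.ε ^ 2 := by nlinarith
  have hzbox : z ∈ D.box := ⟨hz, hAz, hBz⟩
  have hcont : Continuous fun r => f (θ (r, z)) := hf.comp (h.continuous_orbit z)
  rcases hB0nn.eq_or_lt with hB0 | hBpos
  · -- `B₀ = 0`: down the stable disc to `A = η`
    have hconf := D.forall_mem_box_of_sqSumGE_eq_zero h hzbox hB0.symm
    -- at time `t* = log(A₀/η)/2 ≥ 0`, `A = η`
    set tstar : ℝ := Real.log (A₀ / η) / 2 with htstar
    have hratio : 1 ≤ A₀ / η := by rw [le_div_iff₀ hη]; linarith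
    have htstar0 : 0 ≤ tstar := by
      have := Real.log_nonneg hratio
      rw [htstar]; linarith
    have hAt : sqSumLT D.k (D.coord (θ (tstar, z))) = η := by
      rw [(hconf tstar htstar0).2.2]
      have : Real.exp (-2 * tstar) = η / A₀ := by
        rw [htstar, show -2 * (Real.log (A₀ / η) / 2) = -Real.log (A₀ / η) by ring, Real.exp_neg,
          Real.exp_log (by positivity), inv_div]
      rw [this, div_mul_cancel₀ _ hApos.ne']
    refine ⟨tstar, htstar0, fun r hr => D.box_subset_closedBox (hconf r hr.1).1, ?_⟩
    rw [D.apply_eq_sub_add (hconf tstar htstar0).1.1, hAt, (hconf tstar htstar0).2.1]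
    ring
  · -- `B₀ > 0`: the exit lemma, then the intermediate value theorem
    obtain ⟨T, hT0, hseg, hBT, hPT⟩ := D.exists_exit h hzbox hBpos
    have hAT : sqSumLT D.k (D.coord (θ (T, z))) < η := by
      have h4 : 0 < 4 * D.ε ^ 2 := by positivity
      have : 4 * D.ε ^ 2 * sqSumLT D.k (D.coord (θ (T, z))) < 4 * D.ε ^ 2 * η := by
        rw [hPT]; linarith
      exact lt_of_mul_lt_mul_left this h4.le
    have hfT : f c - η < f (θ (T, z)) := by
      rw [D.apply_eq_sub_add (hseg T ⟨hT0, le_rfl⟩).1, hBT]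
      nlinarith
    have hf0 : f (θ (0, z)) ≤ f c - η := by rw [h.map_zero]; exact hfz
    obtain ⟨t, ht, hteq⟩ := intermediate_value_Icc hT0 hcont.continuousOn ⟨hf0, hfT.le⟩
    exact ⟨t, ht.1, fun r hr => hseg r ⟨hr.1, hr.2.trans ht.2⟩, hteq⟩

end MilnorBox

/-! ### Consequences for the global flow -/

section GlobalFlow

variable [IsManifold (𝓡 4) ∞ M] [T2Space M] [CompactSpace M]
  {ξ : Π x : M, TangentSpace (𝓡 4) x}
  {hξ : ContMDiff (𝓡 4) (𝓡 4).tangent ∞ fun x => (⟨x, ξ x⟩ : TangentBundle (𝓡 4) M)}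

/-- **The level projection of a tube point below the level, read in the box.**  For `z` in the
chart domain of an index-`2` box of `(f, ξ)` with `f z ≤ f c - η`, `A(z) ≤ A_max < ε²`,
`A(z) B(z) < 4ηε²` (`0 < η`, the level regular): `z` hits the level `f c - η`, `π z = flow z t`
with `t ≥ 0`, the orbit segment lies in the closed box, and `A·B` and the tube function `𝒯` are
conserved; on the level `A(π z) = η + B(π z)`. [cite: MilnorHCobordism1965, proof of Thm. 3.12; Thm. 4.1]
[cite: GayKirby2016, §4, Lemma 14] -/
theorem MilnorBox.exists_levelProj_eq_flow_of_le (D : MilnorBox (𝓡 4) f ξ c) (hk : D.k = 2)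
    (hgl : IsGradientLike (𝓡 4) f ξ) (hfM : IsMorse (𝓡 4) f) {η Amax : ℝ} (hη : 0 < η)
    (hAmax : Amax < D.ε ^ 2) (hreg : ∀ x, f x = f c - η → ¬ IsMCriticalPt (𝓡 4) f x)
    {z : M} (hz : z ∈ D.chart.source) (hA : sqSumLT D.k (D.coord z) ≤ Amax) (hfz : f z ≤ f c - η)
    (hP : sqSumLT D.k (D.coord z) * sqSumGE D.k (D.coord z) < 4 * η * D.ε ^ 2) :
    ∃ t, 0 ≤ t ∧ Hits (flowθ hξ) f (f c - η) z ∧ levelProj hξ f (f c - η) z = flow hξ z t ∧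
      (∀ r ∈ Icc 0 t, flow hξ z r ∈ {q' | q' ∈ D.chart.source ∧ sqSumLT D.k (D.coord q') ≤ D.ε ^ 2 ∧
        sqSumGE D.k (D.coord q') ≤ 4 * D.ε ^ 2}) ∧
      sqSumLT D.k (D.coord (flow hξ z t)) * sqSumGE D.k (D.coord (flow hξ z t)) =
        sqSumLT D.k (D.coord z) * sqSumGE D.k (D.coord z) ∧
      (∀ ε' κ η' : ℝ, TubeModel.tube ε' κ η' (D.coord (flow hξ z t)) = TubeModel.tube ε' κ η' (D.coord z)) ∧
      sqSumLT D.k (D.coord (flow hξ z t)) = η + sqSumGE D.k (D.coord (flow hξ z t)) := by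
  have hθ : IsFlowOf (𝓡 4) ξ (flowθ hξ) := (isSmoothFlow_flow hξ).isFlowOf
  obtain ⟨t, ht, hseg, hft⟩ := D.exists_forward_level hθ hfM.contMDiff.continuous hη hAmax hz hA hfz hP
  have hft' : f (flow hξ z t) = f c - η := hft
  have hhits : Hits (flowθ hξ) f (f c - η) z := ⟨t, hft⟩
  have hproj : levelProj hξ f (f c - η) z = flow hξ z t := by
    rw [← hgl.levelProj_flow hfM hξ hreg hhits t, hgl.levelProj_of_apply_eq hfM hξ hreg hft']
  have hsrc : ∀ r ∈ Icc 0 t, flowθ hξ (r, z) ∈ D.chart.source := fun r hr => (hseg r hr).1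
  have hP' := hθ.sqSumLT_mul_sqSumGE_coord_eq D ht hsrc
  simp only [flowθ, flow_zero] at hP'
  -- `A > 0` at time `0`: `A₀ ≥ η`
  have hA0 : 0 < sqSumLT D.k (D.coord (flowθ hξ (0, z))) := by
    have hfz' : f z = f c - sqSumLT D.k (D.coord z) + sqSumGE D.k (D.coord z) := D.apply_eq_sub_add hz
    have : 0 < sqSumLT D.k (D.coord z) := by linarith [sqSumGE_nonneg D.k (D.coord z)]
    simpa [flowθ, flow_zero] using this
  have htube : ∀ ε' κ η' : ℝ, TubeModel.tube ε' κ η' (D.coord (flow hξ z t)) = TubeModel.tube ε' κ η' (D.coord z) := by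
    intro ε' κ η'
    have := hθ.tube_coord_eq D hk ε' κ η' ht hsrc hA0
    simpa [flowθ, flow_zero] using this
  have hlevel : sqSumLT D.k (D.coord (flow hξ z t)) = η + sqSumGE D.k (D.coord (flow hξ z t)) := by
    have := D.apply_eq_sub_add (hseg t ⟨ht, le_rfl⟩).1
    rw [hft'] at this
    linarith
  exact ⟨t, ht, hhits, hproj, hseg, hP', htube, hlevel⟩

end GlobalFlow

end Literature.Topology.FourManifolds

end
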